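import Literature.NumberTheory.Sieve.MatomakiRadziwillTheorem3VK
import Literature.NumberTheory.LFunctions.VinogradovZetaSumEstimate
import HarnessLib

/-!
# Matomäki–Radziwiłł 2016, Theorem 3: the discharge

Topic `Literature/NumberTheory/Sieve`.  Everything in this file is PROVED; no definitions, no named facts.

K. Matomäki, M. Radziwiłł, *Multiplicative functions in short intervals*, Ann. of Math. (2) 183 (2016),
1015–1056, **Theorem 3** (arXiv:1501.04585 p. 6; proof §9, p. 19): "Let `f : ℕ → [-1,1]` be a
multiplicative function. Let `𝒮 = 𝒮_X` be as above with `η ∈ (0, 1/6)`. If `[P_1, Q_1] ⊂ [1, h]`, then for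
all `X > X(η)` large enough
`(1/X) ∫_X^{2X} |(1/h) ∑_{x ≤ n ≤ x+h, n ∈ 𝒮} f(n) - (1/X) ∑_{X ≤ n ≤ 2X, n ∈ 𝒮} f(n)|² dx
  ≪ (log h)^{1/3} / P_1^{1/6-η} + (log X)^{-1/50}`."
It is vendored as the named fact `MatomakiRadziwill2016_theorem3` (`MatomakiRadziwill.lean`); this file
proves it:

* `MatomakiRadziwill2016_theorem3_holds : MatomakiRadziwill2016_theorem3`.

The proof is the paper's, assembled from pieces proved across the tree, in the paper's order:

1. §9 ("Proof of Theorem 3"): Theorem 3 from Lemma 14 (Parseval), Lemma 4 (Lipschitz bound of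
   Granville–Soundararajan type) with Lemma 5 (inclusion–exclusion over `𝒮`), and Proposition 1 —
   `MatomakiRadziwill2016_theorem3_of_prop1_real` (`MatomakiRadziwillTheorem3.lean`), fed with
   `MatomakiRadziwill2016_lemma14_real_holds` (`MatomakiRadziwillLemma14.lean`) and
   `MatomakiRadziwill2016_lemma4_holds` (`MatomakiRadziwillTheorem3VK.lean`, from Granville–Soundararajan
   2003, Theorems 1, 3, 4 (central range) and Corollary 3, all proved in `LFunctions/GranvilleSoundararajan*`).
2. §8: Proposition 1 from Lemmas 3, 7, 9, 11, 12, 13 — `MatomakiRadziwill2016_prop1_of_lemma3_lemma11`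
   (`MatomakiRadziwillProp1*.lean`; Lemmas 7, 9 (Halász–Montgomery), 12, 13 proved there).
3. §2, §4: Lemma 3 from the sharp Halász theorem (Granville–Soundararajan 2003, Cor. 1, proved) and
   Lemma 2, whose constant `1/3 - ε` is the Vinogradov–Korobov zero-free region for `ζ`
   (`MatomakiRadziwill2016_lemma3_of_GS_tail`, `TwistedPrimeSumTail.…_of_vk`); Lemma 11 (Halász for primes)
   from the same region and the explicit formula (`MatomakiRadziwill2016_lemma11_of_vk`).  These give
   `MatomakiRadziwill2016_theorem3_of_vk : 0 < c → HasVKZeroFreeRegion c T₀ → MatomakiRadziwill2016_theorem3`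
   (`MatomakiRadziwillTheorem3VK.lean`).
4. The one classical input, a Vinogradov–Korobov zero-free region, is a theorem of the tree:
   `VKZeta.exists_hasVKZeroFreeRegion : ∃ c > 0, HasVKZeroFreeRegion c 21`
   (`LFunctions/VinogradovZetaSumEstimate.lean`), proved from Vinogradov's mean value theorem
   (Ivić 1985, Lemmas 6.1–6.3, `VinogradovMeanValue*.lean`) through the Vinogradov–Korobov estimate for
   zeta sums (Ivić, Theorem 6.2, `VinogradovZetaSum*.lean`), Richert-type bounds
   (`RichertBoundsFromExpSum.lean`) and the zero-detector argument (`VinogradovKorobovFromRichert.lean`).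

So Theorem 3 of Matomäki–Radziwiłł holds outright, with axiom closure `propext`, `Classical.choice`,
`Quot.sound`.

## References
* K. Matomäki, M. Radziwiłł, *Multiplicative functions in short intervals*, Ann. of Math. (2) 183 (2016),
  1015–1056, doi:10.4007/annals.2016.183.3.6 (arXiv:1501.04585): Theorem 3 (p. 6), §9 "Proof of
  Theorem 3" (p. 19), §8 (Proposition 1), Lemmas 2–5, 11–14. [MatomakiRadziwillAnnals2016]
* A. Granville, K. Soundararajan, *Decay of mean values of multiplicative functions*, Canad. J. Math. 55
  (2003), 1191–1230. [GranvilleSoundararajan2003]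
* A. Ivić, *The Riemann Zeta-Function*, Wiley 1985, §6.2–6.3 (Lemmas 6.1–6.3, Theorems 6.1–6.2). [Ivic1985]
-/

namespace Literature.NumberTheory.Sieve

open Literature.NumberTheory.LFunctions

/-- **Matomäki–Radziwiłł 2016, Theorem 3**, PROVED: for every `η ∈ (0, 1/6)` there are `C, X₀` such that
for all `X ≥ X₀`, every system of sieve intervals `𝒮_X` with parameter `η`, every real multiplicative
`f : ℕ → [-1, 1]` and every `Q_1 ≤ h ≤ X`,
`(1/X) ∫_X^{2X} |(1/h) ∑_{x ≤ n ≤ x+h, n ∈ 𝒮} f(n) - (1/X) ∑_{X ≤ n ≤ 2X, n ∈ 𝒮} f(n)|² dx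
  ≤ C ((log h)^{1/3} / P_1^{1/6-η} + (log X)^{-1/50})`
(the statement vendored as `MatomakiRadziwill2016_theorem3`).  Proof: the paper's §9/§8/§4/§2 chain as
proved in the tree (`MatomakiRadziwill2016_theorem3_of_vk`), applied to the tree's unconditional
Vinogradov–Korobov zero-free region `VKZeta.exists_hasVKZeroFreeRegion` (from Vinogradov's mean value
theorem). [cite: MatomakiRadziwillAnnals2016, Theorem 3 (p. 6) and §9 (p. 19)] -/
theorem MatomakiRadziwill2016_theorem3_holds : MatomakiRadziwill2016_theorem3 := by
  obtain ⟨c, hc, hVK⟩ := VKZeta.exists_hasVKZeroFreeRegion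
  exact MatomakiRadziwill2016_theorem3_of_vk hc hVK

end Literature.NumberTheory.Sieve
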